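import Literature.NumberTheory.ComplexMultiplication.CMFieldConjSquareQuadraticSubfields
import Literature.AlgebraicGeometry.Pohlmann1968.NondegenerateCMTypeDivisorGenerated
import Summits.HodgeConjecture.CorCM.LinearlyDisjointCMFieldsHodge
import HarnessLib

/-!
# `E^a × A^b` for a CM elliptic curve `E` and a CM abelian variety `A` whose CM field is CYCLIC over `ℚ` of degree
# `≡ 0 (mod 4)`: slotwise independence, `B• = D•`, and the Hodge conjecture — unconditionally

COR-CM (cell `pub-hodgecm2`, binder seat `b23` gen 27), count-neutral; NEW as stated, hence under `Summits/`.  The first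
instance of the linear-disjointness criterion (`Summits/HodgeConjecture/CorCM/LinearlyDisjointCMFieldsHodge`,
`hodgeConjectureFor_prod_of_normalClosure_inf_eq_bot`) that is NEITHER a coprime-cyclotomic family
(`IndependentCMFieldsHodge`, `Census/CoprimeCyclotomicProducts357*`) NOR a family over one imaginary quadratic field
(`QuadraticCMFamiliesHodge`): a TWO-SLOT family `(K_{i₀}, K_{i₁})` with

* `K_{i₀}` an imaginary quadratic field (every CM type of it is nondegenerate — CM elliptic curves), and
* `K_{i₁}` a CM field GALOIS over `ℚ` with CYCLIC Galois group of order `≡ 0 (mod 4)` — e.g. any cyclic quartic CM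
  field such as `ℚ(ζ_5)`, or `ℚ(ζ_p)` for a prime `p ≡ 1 (mod 4)` — carrying a nondegenerate CM type `Φ_{i₁}`.

By `Literature.NumberTheory.ComplexMultiplication.CMFieldConjSquareQuadraticSubfields`
(`normalClosure_inf_normalClosure_eq_bot_of_isCyclic`: complex conjugation pulled back to `K_{i₁}` is an involution
of a cyclic group of order `4m`, hence a square, hence fixes every quadratic subfield, so `K_{i₁}` contains no
imaginary quadratic field) the Galois closures meet in `ℚ`, so `Aut(ℂ)` acts slotwise independently on the embeddings
(`slotwiseIndependent_of_quadratic_of_cyclic`) and every product `⨁_{j<N} A_{π j}` — every `E^a × A^b` — of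
realisations has `Bᵐ ⊗ ℂ = Dᵐ ⊗ ℂ` (`hodgeClassSpan_prod_eq_divisorClassesSpan_of_quadratic_of_cyclic`) and satisfies
the Hodge conjecture (`hodgeConjectureFor_prod_of_quadratic_of_cyclic`), with NO named fact.  The cyclotomic instance
`hodgeConjectureFor_prod_of_quadratic_of_cyclotomic_prime_one_mod_four` covers e.g. `E_{ℚ(√−5)}^a × S^b` for a
`ℚ(ζ_5)`-CM abelian surface `S` of primitive type — the conductors `20` and `5` are NOT coprime, so the
coprime-cyclotomic files do not apply, and the two fields are different, so the quadratic-family files do not either.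

The SHARP form (appended): the cyclicity hypothesis may be replaced by `IsSquare (conjGal : K_{i₁} ≃ₐ[ℚ] K_{i₁})` —
complex conjugation a square in `Gal(K_{i₁}/ℚ)` — via `normalClosure_inf_normalClosure_eq_bot_of_isSquare_conjGal`:
`normalClosure_inf_iSup_eq_bot_of_quadratic_of_isSquare_conjGal`, `slotwiseIndependent_of_quadratic_of_isSquare_conjGal`,
`hodgeClassSpan_prod_eq_divisorClassesSpan_of_quadratic_of_isSquare_conjGal`,
**`hodgeConjectureFor_prod_of_quadratic_of_isSquare_conjGal`** (covers non-cyclic Galois CM fields such as `ℚ(ζ_{65})`).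

Everything is a short application; theorems only (one private lattice lemma), no definition, no `sorry`.

## References

* [Gordon1999HodgeAVSurvey] B. B. Gordon, *A survey of the Hodge conjecture for abelian varieties*, §3 Theorem (Imai,
  Murty) with proof; 7.5; 10.10.
* [Lang2002] S. Lang, *Algebra*, 3rd ed., VI §1 Cor. 1.4 and Thm. 1.14.
* [Washington1997] L. C. Washington, *Introduction to Cyclotomic Fields*, Thm. 2.5.
-/

noncomputable section

open CategoryTheory CategoryTheory.Limits NumberField IntermediateField

namespace Summit.HodgeConjecture.CorCM

open Literature.NumberTheory.ComplexMultiplication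
open Literature.AlgebraicGeometry.Motives (AbelianVariety CMType)
open Literature.AlgebraicGeometry.HodgeTheory
open Literature.AlgebraicGeometry.ComplexMultiplication (IsCMTypeRealisation)
open Literature.AlgebraicGeometry.VanGeemen1994 (hodgeClassSpan)
open Literature.AlgebraicGeometry.Pohlmann1968
open Literature.Barriers.HodgeConjecture (divisorClassesSpan)

/-- In a two-element index type `{i₀, i₁}`, the supremum over the indices `≠ i₀` is the value at `i₁`. [folklore] -/
private theorem iSup_subtype_ne_eq {I : Type} {α : Type*} [CompleteLattice α] {i₀ i₁ : I} (h01 : i₀ ≠ i₁)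
    (hI : ∀ j, j = i₀ ∨ j = i₁) (f : I → α) : (⨆ j : {j : I // j ≠ i₀}, f j.1) = f i₁ := by
  apply le_antisymm
  · refine iSup_le fun j => ?_
    obtain ⟨j, hj⟩ := j
    rcases hI j with rfl | rfl
    · exact absurd rfl hj
    · exact le_rfl
  · exact le_iSup (fun j : {j : I // j ≠ i₀} => f j.1) ⟨i₁, fun h => h01 h.symm⟩

section TwoSlots

variable {I : Type} {K : I → Type} [∀ i, Field (K i)] [∀ i, NumberField (K i)] [∀ i, IsCMField (K i)] [Fintype I]
  [Nonempty I]

omit [Fintype I] [Nonempty I] in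
/-- **The Galois closures of an imaginary quadratic field and of a cyclic CM field of degree `≡ 0 (mod 4)` meet in
`ℚ`, slot by slot**: for the two-slot family `(K_{i₀}, K_{i₁})` the hypothesis of
`hodgeConjectureFor_prod_of_normalClosure_inf_eq_bot` holds. [cite: Lang2002, VI §1 Cor. 1.4 and Thm. 1.14] -/
theorem normalClosure_inf_iSup_eq_bot_of_quadratic_of_cyclic {i₀ i₁ : I} (h01 : i₀ ≠ i₁)
    (hI : ∀ j, j = i₀ ∨ j = i₁) (h0 : Module.finrank ℚ (K i₀) = 2) [IsGalois ℚ (K i₁)]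
    [IsCyclic (K i₁ ≃ₐ[ℚ] K i₁)] (h4 : 4 ∣ Module.finrank ℚ (K i₁)) (i : I) :
    normalClosure ℚ (K i) ℂ ⊓ (⨆ j : {j : I // j ≠ i}, normalClosure ℚ (K j.1) ℂ) = ⊥ := by
  rcases hI i with rfl | rfl
  · rw [iSup_subtype_ne_eq h01 hI (fun j => normalClosure ℚ (K j) ℂ)]
    exact normalClosure_inf_normalClosure_eq_bot_of_isCyclic h0 h4
  · rw [iSup_subtype_ne_eq (Ne.symm h01) (fun j => (hI j).symm) (fun j => normalClosure ℚ (K j) ℂ)]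
    exact normalClosure_inf_normalClosure_eq_bot_of_isCyclic' h0 h4

omit [Nonempty I] in
/-- **Slotwise independence** of `Aut(ℂ)` on the embeddings of an imaginary quadratic field and a cyclic CM field of
degree `≡ 0 (mod 4)`. [cite: Gordon1999HodgeAVSurvey, §3 Theorem (proof)] [cite: Lang2002, VI §1 Thm. 1.14] -/
theorem slotwiseIndependent_of_quadratic_of_cyclic {i₀ i₁ : I} (h01 : i₀ ≠ i₁) (hI : ∀ j, j = i₀ ∨ j = i₁)
    (h0 : Module.finrank ℚ (K i₀) = 2) [IsGalois ℚ (K i₁)] [IsCyclic (K i₁ ≃ₐ[ℚ] K i₁)]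
    (h4 : 4 ∣ Module.finrank ℚ (K i₁)) : SlotwiseIndependent (ℂ ≃+* ℂ) fun i => K i →+* ℂ :=
  slotwiseIndependent_of_normalClosure_inf_eq_bot (normalClosure_inf_iSup_eq_bot_of_quadratic_of_cyclic h01 hI h0 h4)

/-- **Nondegenerate family ⟺ nondegenerate second slot**: for the two-slot family, `(Φ_{i₀}, Φ_{i₁})` is
nondegenerate iff `Φ_{i₁}` is (every CM type of the imaginary quadratic `K_{i₀}` is nondegenerate).
[cite: Gordon1999HodgeAVSurvey, §3 Theorem and 7.5] -/
theorem isNondegenerateFamily_iff_of_quadratic_of_cyclic {i₀ i₁ : I} (h01 : i₀ ≠ i₁) (hI : ∀ j, j = i₀ ∨ j = i₁)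
    (h0 : Module.finrank ℚ (K i₀) = 2) [IsGalois ℚ (K i₁)] [IsCyclic (K i₁ ≃ₐ[ℚ] K i₁)]
    (h4 : 4 ∣ Module.finrank ℚ (K i₁)) (Φ : ∀ i, CMType (K i)) :
    CMAlgebra.IsNondegenerateFamily Φ ↔ IsNondegenerate (Φ i₁) := by
  rw [isNondegenerateFamily_iff_forall_isNondegenerate (slotwiseIndependent_of_quadratic_of_cyclic h01 hI h0 h4) Φ]
  refine ⟨fun h => h i₁, fun h i => ?_⟩
  rcases hI i with rfl | rfl
  · exact isNondegenerate_of_finrank_eq_two (Φ _) h0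
  · exact h

variable {Φ : ∀ i, CMType (K i)}
variable {A : I → AbelianVariety ℂ} {ι : ∀ i, 𝓞 (K i) →+* End (A i)}
  {θ : ∀ i, K i →+* Module.End ℂ (complexBetti (A i).X 1)}

omit [Fintype I] [Nonempty I] in
/-- Both types of the two-slot family are nondegenerate as soon as the second is. [cite: Kubota1965, §2 (p. 115)] -/
private theorem forall_isNondegenerate_of_two_slots {i₀ i₁ : I} (hI : ∀ j, j = i₀ ∨ j = i₁)
    (h0 : Module.finrank ℚ (K i₀) = 2) (hΦ : IsNondegenerate (Φ i₁)) : ∀ i, IsNondegenerate (Φ i) := by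
  intro i
  rcases hI i with rfl | rfl
  · exact isNondegenerate_of_finrank_eq_two (Φ _) h0
  · exact hΦ

/-- **`Bᵐ ⊗ ℂ = Dᵐ ⊗ ℂ` on every `E^a × A^b`** (every product `⨁_{j<N} A_{π j}` of realisations): `E` a CM elliptic curve
with CM by the imaginary quadratic `K_{i₀}`, `A` a realisation of a nondegenerate CM type of a CM field `K_{i₁}` Galois
over `ℚ` with cyclic group of order `≡ 0 (mod 4)`. [cite: Gordon1999HodgeAVSurvey, §3 Theorem (2) and 7.5] -/
theorem hodgeClassSpan_prod_eq_divisorClassesSpan_of_quadratic_of_cyclic {i₀ i₁ : I} (h01 : i₀ ≠ i₁)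
    (hI : ∀ j, j = i₀ ∨ j = i₁) (h0 : Module.finrank ℚ (K i₀) = 2) [IsGalois ℚ (K i₁)]
    [IsCyclic (K i₁ ≃ₐ[ℚ] K i₁)] (h4 : 4 ∣ Module.finrank ℚ (K i₁)) (hΦ : IsNondegenerate (Φ i₁))
    (hA : ∀ i, IsCMTypeRealisation (Φ i) (A i) (ι i) (θ i)) {N : ℕ} (π : Fin N → I) (m : ℕ) :
    hodgeClassSpan (⨁ fun j : Fin N => A (π j)).dim (⨁ fun j : Fin N => A (π j)).X m =
      divisorClassesSpan (⨁ fun j : Fin N => A (π j)).X (⨁ fun j : Fin N => A (π j)).dim m :=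
  hodgeClassSpan_prod_eq_divisorClassesSpan_of_slotwiseIndependent
    (slotwiseIndependent_of_quadratic_of_cyclic h01 hI h0 h4) (forall_isNondegenerate_of_two_slots hI h0 hΦ) hA π m

/-- **No `E^a × A^b` of this kind supports an exotic Hodge class.** [cite: Gordon1999HodgeAVSurvey, §3 Theorem (2) and 7.5] -/
theorem not_exists_exceptional_prod_of_quadratic_of_cyclic {i₀ i₁ : I} (h01 : i₀ ≠ i₁)
    (hI : ∀ j, j = i₀ ∨ j = i₁) (h0 : Module.finrank ℚ (K i₀) = 2) [IsGalois ℚ (K i₁)]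
    [IsCyclic (K i₁ ≃ₐ[ℚ] K i₁)] (h4 : 4 ∣ Module.finrank ℚ (K i₁)) (hΦ : IsNondegenerate (Φ i₁))
    (hA : ∀ i, IsCMTypeRealisation (Φ i) (A i) (ι i) (θ i)) {N : ℕ} (π : Fin N → I) (m : ℕ) :
    ¬∃ c : complexBetti (⨁ fun j : Fin N => A (π j)).X (2 * m), IsRationalClass c ∧
        IsOfHodgeType (⨁ fun j : Fin N => A (π j)).dim (⨁ fun j : Fin N => A (π j)).X (2 * m) m m c ∧
        c ∉ divisorClassesSpan (⨁ fun j : Fin N => A (π j)).X (⨁ fun j : Fin N => A (π j)).dim m :=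
  not_exists_exceptional_prod_of_slotwiseIndependent (slotwiseIndependent_of_quadratic_of_cyclic h01 hI h0 h4)
    (forall_isNondegenerate_of_two_slots hI h0 hΦ) hA π m

/-- **The Hodge conjecture for every `E^a × A^b`** (every product `⨁_{j<N} A_{π j}` of realisations of the two-slot
family): `E` a CM elliptic curve with CM by an imaginary quadratic field `K_{i₀}`, `A` a realisation of a NONDEGENERATE
CM type of a CM field `K_{i₁}` that is Galois over `ℚ` with CYCLIC Galois group of order `≡ 0 (mod 4)` (any cyclic
quartic CM field; `ℚ(ζ_p)`, `p ≡ 1 (mod 4)`), UNCONDITIONAL — no named fact.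
[cite: Gordon1999HodgeAVSurvey, §3 Theorem and 10.10] [cite: Lang2002, VI §1 Cor. 1.4 and Thm. 1.14] -/
theorem hodgeConjectureFor_prod_of_quadratic_of_cyclic {i₀ i₁ : I} (h01 : i₀ ≠ i₁) (hI : ∀ j, j = i₀ ∨ j = i₁)
    (h0 : Module.finrank ℚ (K i₀) = 2) [IsGalois ℚ (K i₁)] [IsCyclic (K i₁ ≃ₐ[ℚ] K i₁)]
    (h4 : 4 ∣ Module.finrank ℚ (K i₁)) (hΦ : IsNondegenerate (Φ i₁))
    (hA : ∀ i, IsCMTypeRealisation (Φ i) (A i) (ι i) (θ i)) {N : ℕ} (π : Fin N → I) :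
    HodgeConjectureFor (⨁ fun j : Fin N => A (π j)).dim (⨁ fun j : Fin N => A (π j)).X :=
  hodgeConjectureFor_prod_of_slotwiseIndependent (slotwiseIndependent_of_quadratic_of_cyclic h01 hI h0 h4)
    (forall_isNondegenerate_of_two_slots hI h0 hΦ) hA π

/-- **Cyclotomic instance: the Hodge conjecture for every `E^a × A^b` with `E` a CM elliptic curve (any imaginary
quadratic field) and `A` a realisation of a nondegenerate CM type of a `p`-th CYCLOTOMIC field, `p ≡ 1 (mod 4)`** —
e.g. `E_{ℚ(√−5)}^a × S^b` for a `ℚ(ζ_5)`-CM abelian surface `S` of primitive type (conductors `20`, `5` not coprime).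
[cite: Gordon1999HodgeAVSurvey, §3 Theorem and 10.10] [cite: Washington1997, Thm. 2.5] -/
theorem hodgeConjectureFor_prod_of_quadratic_of_cyclotomic_prime_one_mod_four {i₀ i₁ : I} (h01 : i₀ ≠ i₁)
    (hI : ∀ j, j = i₀ ∨ j = i₁) (h0 : Module.finrank ℚ (K i₀) = 2) (p : ℕ) [Fact p.Prime] (hp1 : p % 4 = 1)
    [IsCyclotomicExtension {p} ℚ (K i₁)] (hΦ : IsNondegenerate (Φ i₁))
    (hA : ∀ i, IsCMTypeRealisation (Φ i) (A i) (ι i) (θ i)) {N : ℕ} (π : Fin N → I) :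
    HodgeConjectureFor (⨁ fun j : Fin N => A (π j)).dim (⨁ fun j : Fin N => A (π j)).X := by
  haveI : IsGalois ℚ (K i₁) := IsCyclotomicExtension.isGalois {p} ℚ (K i₁)
  haveI : IsCyclic (K i₁ ≃ₐ[ℚ] K i₁) := isCyclic_algEquiv_of_isCyclotomicExtension_prime p (K i₁)
  refine hodgeConjectureFor_prod_of_quadratic_of_cyclic h01 hI h0 ?_ hΦ hA π
  rw [finrank_of_isCyclotomicExtension_prime p (K i₁)]
  have h2 : 2 ≤ p := (Fact.out : p.Prime).two_le
  omega

end TwoSlots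

/-! ### The sharp form: complex conjugation a square in `Gal(K_{i₁}/ℚ)` (appended 2026-08-21, same seat) -/

section ConjSquare

variable {I : Type} {K : I → Type} [∀ i, Field (K i)] [∀ i, NumberField (K i)] [∀ i, IsCMField (K i)] [Fintype I]
  [Nonempty I]

omit [Fintype I] [Nonempty I] in
/-- **Slot by slot**: for the two-slot family with `K_{i₀}` imaginary quadratic and `K_{i₁}` Galois over `ℚ` with
`conjGal` a square in `Gal(K_{i₁}/ℚ)`, the Galois closures meet in `ℚ`. [cite: Lang2002, VI §1 Cor. 1.4 and Thm. 1.14] -/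
theorem normalClosure_inf_iSup_eq_bot_of_quadratic_of_isSquare_conjGal {i₀ i₁ : I} (h01 : i₀ ≠ i₁)
    (hI : ∀ j, j = i₀ ∨ j = i₁) (h0 : Module.finrank ℚ (K i₀) = 2) [IsGalois ℚ (K i₁)]
    (hsq : IsSquare (conjGal : K i₁ ≃ₐ[ℚ] K i₁)) (i : I) :
    normalClosure ℚ (K i) ℂ ⊓ (⨆ j : {j : I // j ≠ i}, normalClosure ℚ (K j.1) ℂ) = ⊥ := by
  rcases hI i with rfl | rfl
  · rw [iSup_subtype_ne_eq h01 hI (fun j => normalClosure ℚ (K j) ℂ)]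
    exact normalClosure_inf_normalClosure_eq_bot_of_isSquare_conjGal h0 hsq
  · rw [iSup_subtype_ne_eq (Ne.symm h01) (fun j => (hI j).symm) (fun j => normalClosure ℚ (K j) ℂ)]
    exact normalClosure_inf_normalClosure_eq_bot_of_isSquare_conjGal' h0 hsq

omit [Nonempty I] in
/-- **Slotwise independence, sharp form.** [cite: Gordon1999HodgeAVSurvey, §3 Theorem (proof)] [cite: Lang2002, VI §1 Thm. 1.14] -/
theorem slotwiseIndependent_of_quadratic_of_isSquare_conjGal {i₀ i₁ : I} (h01 : i₀ ≠ i₁)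
    (hI : ∀ j, j = i₀ ∨ j = i₁) (h0 : Module.finrank ℚ (K i₀) = 2) [IsGalois ℚ (K i₁)]
    (hsq : IsSquare (conjGal : K i₁ ≃ₐ[ℚ] K i₁)) : SlotwiseIndependent (ℂ ≃+* ℂ) fun i => K i →+* ℂ :=
  slotwiseIndependent_of_normalClosure_inf_eq_bot
    (normalClosure_inf_iSup_eq_bot_of_quadratic_of_isSquare_conjGal h01 hI h0 hsq)

variable {Φ : ∀ i, CMType (K i)}
variable {A : I → AbelianVariety ℂ} {ι : ∀ i, 𝓞 (K i) →+* End (A i)}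
  {θ : ∀ i, K i →+* Module.End ℂ (complexBetti (A i).X 1)}

/-- **`Bᵐ ⊗ ℂ = Dᵐ ⊗ ℂ` on every `E^a × A^b`, sharp form** (`conjGal` a square in `Gal(K_{i₁}/ℚ)`, `Φ_{i₁}`
nondegenerate). [cite: Gordon1999HodgeAVSurvey, §3 Theorem (2) and 7.5] -/
theorem hodgeClassSpan_prod_eq_divisorClassesSpan_of_quadratic_of_isSquare_conjGal {i₀ i₁ : I} (h01 : i₀ ≠ i₁)
    (hI : ∀ j, j = i₀ ∨ j = i₁) (h0 : Module.finrank ℚ (K i₀) = 2) [IsGalois ℚ (K i₁)]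
    (hsq : IsSquare (conjGal : K i₁ ≃ₐ[ℚ] K i₁)) (hΦ : IsNondegenerate (Φ i₁))
    (hA : ∀ i, IsCMTypeRealisation (Φ i) (A i) (ι i) (θ i)) {N : ℕ} (π : Fin N → I) (m : ℕ) :
    hodgeClassSpan (⨁ fun j : Fin N => A (π j)).dim (⨁ fun j : Fin N => A (π j)).X m =
      divisorClassesSpan (⨁ fun j : Fin N => A (π j)).X (⨁ fun j : Fin N => A (π j)).dim m :=
  hodgeClassSpan_prod_eq_divisorClassesSpan_of_slotwiseIndependent
    (slotwiseIndependent_of_quadratic_of_isSquare_conjGal h01 hI h0 hsq)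
    (forall_isNondegenerate_of_two_slots hI h0 hΦ) hA π m

/-- **The Hodge conjecture for every `E^a × A^b`, sharp form**: `E` a CM elliptic curve, `A` a realisation of a
nondegenerate CM type of a CM field `K_{i₁}` Galois over `ℚ` in whose Galois group complex conjugation is a SQUARE
(cyclic of order `≡ 0 (mod 4)`; `ℚ(ζ_n)` with `−1` a square in `(ℤ/n)^×`, e.g. `n = 65`), UNCONDITIONAL.
[cite: Gordon1999HodgeAVSurvey, §3 Theorem and 10.10] [cite: Lang2002, VI §1 Cor. 1.4 and Thm. 1.14] -/
theorem hodgeConjectureFor_prod_of_quadratic_of_isSquare_conjGal {i₀ i₁ : I} (h01 : i₀ ≠ i₁)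
    (hI : ∀ j, j = i₀ ∨ j = i₁) (h0 : Module.finrank ℚ (K i₀) = 2) [IsGalois ℚ (K i₁)]
    (hsq : IsSquare (conjGal : K i₁ ≃ₐ[ℚ] K i₁)) (hΦ : IsNondegenerate (Φ i₁))
    (hA : ∀ i, IsCMTypeRealisation (Φ i) (A i) (ι i) (θ i)) {N : ℕ} (π : Fin N → I) :
    HodgeConjectureFor (⨁ fun j : Fin N => A (π j)).dim (⨁ fun j : Fin N => A (π j)).X :=
  hodgeConjectureFor_prod_of_slotwiseIndependent (slotwiseIndependent_of_quadratic_of_isSquare_conjGal h01 hI h0 hsq)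
    (forall_isNondegenerate_of_two_slots hI h0 hΦ) hA π

end ConjSquare

end Summit.HodgeConjecture.CorCM

end
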